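import Mathlib.RingTheory.PowerSeries.Basic
import Mathlib.RingTheory.PowerSeries.Inverse
import Mathlib.RingTheory.PowerSeries.Order
import Mathlib.RingTheory.PowerSeries.NoZeroDivisors
import Mathlib.RingTheory.UniqueFactorizationDomain.Basic
import Mathlib.Algebra.GroupWithZero.Associated
import Mathlib.Algebra.Divisibility.Units
import HarnessLib

/-!
# Divisibility-transfer lemmas behind the "zeta element ⇒ equivalence of main conjectures" mechanism

Pure commutative algebra, sorry-free, extracted while refereeing Burungale–Skinner–Tian–Wan,
*Zeta elements for elliptic curves and applications* (arXiv:2409.01350v2, PRE) for the cell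
`bsd-ssimc` (seat `bsd-ssimc-bstw`). Nothing about elliptic curves is asserted here; these are the
ring-theoretic skeletons of three steps of that paper (and of Burungale–Castella–Skinner,
IMRN 2025, Thm. 4.1.3, which cites BSTW §9.3.2 for its proof), isolated so that the REMAINING
content of each step is exactly the existence of the exact sequences / the `μ = 0` input.

* `dvd_iff_dvd_of_mul_eq_mul`, `dvd_iff_dvd_of_mul_eq_mul'`,
  `associated_iff_associated_of_mul_eq_mul` — **four-term transfer** (BSTW Part II Prop. 9.18 =
  tex-label `Eq`, §9.3.2; BCS 2025 Thm. 4.1.3). Two four-term exact sequences of torsion modules over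
  a UFD `Λ` with the same outer terms, `0 → H/Z → Λ/(L^Gr) → X_Gr → X_st → 0` and
  `0 → H/Z → Λ/(L_p) → X → X_st → 0`, give by multiplicativity of characteristic ideals
  `a · G = L^Gr · s` and `a · K = L_p · s` with `a = char(H/Z)`, `s = char(X_st)`, `G = char(X_Gr)`,
  `K = char(X)`. In a commutative monoid with zero with cancellation this forces
  `L^Gr ∣ G ↔ a ∣ s ↔ L_p ∣ K` and the same for the opposite divisibilities; that is the whole
  algebraic content of "a one-sided divisibility in one main conjecture implies the analogous
  divisibility in the others".
* `associated_of_dvd_of_dvd_of_mul_dvd_mul` — **divisibility sandwich** (BSTW Part II §10.3, proof of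
  Thm. 10.1 = Thm. 1.3): `L(g)L(g') ∣ ξ(g)ξ(g')` (Eisenstein-congruence side after descent) together
  with `ξ(g) ∣ L(g)`, `ξ(g') ∣ L(g')` (Kato–Kobayashi side) forces `(ξ(g)) = (L(g))`.
* `isUnit_of_dvd_prime_pow_mul_of_not_dvd`, `isRelPrime_of_constantCoeff`,
  `dvd_of_mul_eq_mul_of_constantCoeff` — **`μ = 0` descent** (BSTW Part II §10.2.2, last paragraph of
  the proof of Thm. 10.5 = tex-label `KoMC'_lb`): model the two-variable algebra `Λ_L` as `A⟦X⟧` with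
  `A = ℤ_p⟦γ_ac − 1⟧` and `X = γ_cyc − 1`, so that `PowerSeries.constantCoeff` is restriction to the
  anticyclotomic line and the cyclotomic subalgebra `ℤ_p⟦X⟧` consists of the series whose nonzero
  coefficients are `p^k · unit` in `A`. If the restriction `L(0)` of `L` is nonzero with `p ∤ L(0)`
  (`μ(L^ac) = 0`), then `L` is relatively prime to every nonzero cyclotomic `c`, so a divisibility
  `c · ξ = L · a` ("`L ∣ ξ` in `Λ_L ⊗_{Λ^cyc} Frac Λ^cyc`") upgrades to `L ∣ ξ` in `Λ_L` (given that
  `Λ_L` is a decomposition monoid, e.g. a UFD — true for `ℤ_p⟦T₁,T₂⟧`, a regular local ring, but not an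
  instance Mathlib synthesises, hence the explicit `[DecompositionMonoid A⟦X⟧]` argument).

What is deliberately NOT here: characteristic ideals, Selmer groups, `p`-adic `L`-functions, or any
claim that BSTW's exact sequences exist; those are the refereed paper's burden (see the cell memo
`run/shared/lean/pub/bsd-ssimc/bstw/BSTW-verification.md`). References: Bourbaki AC VII §4.5
(multiplicativity of characteristic ideals), Skinner–Urban Invent. Math. 195 (2014) §3.2 (descent),
BSTW arXiv:2409.01350v2 §9.3.2, §10.2.2, §10.3; BCS IMRN 2025 Thm. 4.1.3.
-/

namespace Literature.NumberTheory.EllipticCurves.IwasawaTransfer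

/-! ### Four-term transfer and the divisibility sandwich (cancellative monoids with zero) -/

section CancelMonoid

variable {α : Type*} [CommMonoidWithZero α] [IsCancelMulZero α]

/-- **Four-term transfer, lower divisibilities.** If `a * G = L * s` with `a, L ≠ 0` (the identity of
characteristic ideals produced by a four-term exact sequence `0 → H/Z → Λ/(L) → X_G → X_s → 0`,
`a = char(H/Z)`, `G = char X_G`, `s = char X_s`), then `L ∣ G ↔ a ∣ s`. Used twice (once per explicit
reciprocity law) this is BCS 2025 Thm. 4.1.3 / BSTW Part II Prop. 1.18 (tex label `Eq`, "§9.3.2") modulo the exact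
sequences. [cite: BurungaleCastellaSkinner2025, Thm. 4.1.3 (proof: four-term transfer; ring-theoretic step only)] -/
theorem dvd_iff_dvd_of_mul_eq_mul {a G L s : α} (ha : a ≠ 0) (hL : L ≠ 0)
    (h : a * G = L * s) : L ∣ G ↔ a ∣ s := by
  constructor
  · rintro ⟨t, rfl⟩
    refine ⟨t, mul_left_cancel₀ hL ?_⟩
    rw [← h, mul_left_comm]
  · rintro ⟨t, rfl⟩
    refine ⟨t, mul_left_cancel₀ ha ?_⟩
    rw [h, mul_left_comm]

/-- **Four-term transfer, upper divisibilities**: under `a * G = L * s` with `G, s ≠ 0`,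
`G ∣ L ↔ s ∣ a` ("the same conclusion holds for the opposite divisibilities").
[cite: BurungaleCastellaSkinner2025, Thm. 4.1.3 (proof: four-term transfer, opposite divisibility; ring-theoretic step only)] -/
theorem dvd_iff_dvd_of_mul_eq_mul' {a G L s : α} (hG : G ≠ 0) (hs : s ≠ 0)
    (h : a * G = L * s) : G ∣ L ↔ s ∣ a := by
  have h' : G * a = s * L := by rw [mul_comm G, h, mul_comm]
  exact (dvd_iff_dvd_of_mul_eq_mul hG hs h').symm

/-- **Four-term transfer, equalities**: under `a * G = L * s` with all four nonzero,
`(L) = (G) ↔ (a) = (s)` as principal ideals, i.e. `Associated L G ↔ Associated a s`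
("in particular, Conjecture 4.1.1 and Conjecture 4.1.2 are equivalent").
[cite: BurungaleCastellaSkinner2025, Thm. 4.1.3 (proof: four-term transfer, equalities; ring-theoretic step only)] -/
theorem associated_iff_associated_of_mul_eq_mul {a G L s : α} (ha : a ≠ 0) (hG : G ≠ 0)
    (hL : L ≠ 0) (hs : s ≠ 0) (h : a * G = L * s) : Associated L G ↔ Associated a s := by
  rw [← dvd_dvd_iff_associated, ← dvd_dvd_iff_associated, dvd_iff_dvd_of_mul_eq_mul ha hL h,
    dvd_iff_dvd_of_mul_eq_mul' hG hs h]

/-- **Chaining two transfers** (BSTW Prop. 9.18: Greenberg ↔ zeta-element ↔ standard main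
conjecture): from `a * G = LGr * s` and `a * K = Lp * s` (both explicit reciprocity laws) with
`a, LGr, Lp ≠ 0`, `LGr ∣ G ↔ Lp ∣ K`.
[cite: BurungaleCastellaSkinner2025, Thm. 4.1.3 (proof: (i) ↔ (ii) via the two four-term sequences; ring-theoretic step only)] -/
theorem dvd_iff_dvd_of_mul_eq_mul_of_mul_eq_mul {a G LGr s K Lp : α} (ha : a ≠ 0)
    (hLGr : LGr ≠ 0) (hLp : Lp ≠ 0) (h₁ : a * G = LGr * s) (h₂ : a * K = Lp * s) :
    LGr ∣ G ↔ Lp ∣ K :=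
  (dvd_iff_dvd_of_mul_eq_mul ha hLGr h₁).trans (dvd_iff_dvd_of_mul_eq_mul ha hLp h₂).symm

/-- **Divisibility sandwich** (BSTW §10.3, last step of the proof of Thm. 1.3 = Thm. 10.1): if
`a ∣ x`, `b ∣ y` and `x * y ∣ a * b` with `x, y ≠ 0`, then `a ~ x` and `b ~ y`. In BSTW:
`a = ξ(X_∘(g))`, `x = L_p^∘(g)`, `b = ξ(X_∘(g'))`, `y = L_p^∘(g')` (`g' = g ⊗ χ_L`), with
`ξ(X_∘(g)) ∣ L_p^∘(g)` and `ξ(X_∘(g')) ∣ L_p^∘(g')` (Kato–Kobayashi, integral under (im)) and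
`L_p^∘(g) L_p^∘(g') ∣ ξ(X_∘(g)) ξ(X_∘(g'))` (Eisenstein side after cyclotomic descent); conclusion
`(ξ(X_∘(g))) = (L_p^∘(g))`. All four elements must be nonzero (Rohrlich/Pollack and
cotorsionness); no coprimality between the `g`- and `g'`-factors is needed.
[cite: BurungaleSkinnerTianWan2024, Part II §2.3 (proof of the theorem labelled KoMC_r = Thm. 1.3; ring-theoretic step only; PREPRINT)] -/
theorem associated_of_dvd_of_dvd_of_mul_dvd_mul {a b x y : α} (hx : x ≠ 0) (hy : y ≠ 0)
    (h₁ : a ∣ x) (h₂ : b ∣ y) (h₃ : x * y ∣ a * b) : Associated a x ∧ Associated b y := by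
  obtain ⟨u, rfl⟩ := h₁
  obtain ⟨v, rfl⟩ := h₂
  have ha : a ≠ 0 := left_ne_zero_of_mul hx
  have hb : b ≠ 0 := left_ne_zero_of_mul hy
  have huv : u * v ∣ 1 := by
    have h' : a * b * (u * v) ∣ a * b * 1 := by
      rw [← mul_mul_mul_comm, mul_one]
      exact h₃
    exact (mul_dvd_mul_iff_left (mul_ne_zero ha hb)).mp h'
  have hu : IsUnit u := isUnit_of_dvd_one (dvd_trans (dvd_mul_right u v) huv)
  have hv : IsUnit v := isUnit_of_dvd_one (dvd_trans (dvd_mul_left v u) huv)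
  exact ⟨⟨hu.unit, by simp⟩, ⟨hv.unit, by simp⟩⟩

/-- A divisor of `ϖ ^ k * u` (`ϖ` prime, `u` a unit) which is not divisible by `ϖ` is a unit.
Elementary; the one-dimensional shadow of "an element of `ℤ_p⟦T⟧` with `μ = 0` dividing a power of `p`
is a unit". [cite: BurungaleSkinnerTianWan2024, Part II §2.2.2 (proof of the theorem labelled KoMC'_lb, last paragraph; ring-theoretic step only; PREPRINT)] -/
theorem isUnit_of_dvd_prime_pow_mul_of_not_dvd {ϖ d u : α} (hϖ : Prime ϖ) (hu : IsUnit u)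
    (hnd : ¬ ϖ ∣ d) : ∀ k : ℕ, d ∣ ϖ ^ k * u → IsUnit d := by
  intro k
  induction k with
  | zero =>
    intro h
    rw [pow_zero, one_mul] at h
    exact isUnit_of_dvd_unit h hu
  | succ k ih =>
    rintro ⟨e, he⟩
    have hdiv : ϖ ∣ d * e := ⟨ϖ ^ k * u, by rw [← he, pow_succ', mul_assoc]⟩
    obtain ⟨e₁, rfl⟩ := (hϖ.dvd_or_dvd hdiv).resolve_left hnd
    apply ih
    refine ⟨e₁, mul_left_cancel₀ hϖ.ne_zero ?_⟩
    rw [← mul_assoc, ← pow_succ', he, mul_left_comm]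

omit [IsCancelMulZero α] in
/-- **Descent of a divisibility from a localisation** (the form in which BSTW §10.2.2 uses
`μ = 0`): in a decomposition monoid (e.g. a UFD), if `c * ξ = L * a` and `L` is relatively prime to
`c`, then `L ∣ ξ`. [cite: BurungaleSkinnerTianWan2024, Part II §2.2.2 (proof of the theorem labelled KoMC'_lb, last paragraph: "the divisibility holds in Λ_L"; ring-theoretic step only; PREPRINT)] -/
theorem dvd_of_mul_eq_mul_of_isRelPrime [DecompositionMonoid α] {c ξ L a : α}
    (hrel : IsRelPrime L c) (h : c * ξ = L * a) : L ∣ ξ :=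
  hrel.dvd_of_dvd_mul_left ⟨a, h⟩

end CancelMonoid

/-! ### `μ = 0` on the anticyclotomic line ⇒ coprimality to the cyclotomic subalgebra -/

section Restriction

open PowerSeries

variable {A : Type*} [CommRing A] [IsDomain A]

/-- In `A⟦X⟧` over a domain: a common divisor `d` of `X ^ m * c'` and of a series `L` with nonzero
constant term divides `c'` (because `X` is prime and `X ∤ d`). Auxiliary. [cite: BurungaleSkinnerTianWan2024, Part II §2.2.2 (proof of the theorem labelled KoMC'_lb, last paragraph; auxiliary ring-theoretic step; PREPRINT)] -/
theorem dvd_of_dvd_X_pow_mul_of_not_X_dvd {d c' : A⟦X⟧} (hXd : ¬ (X : A⟦X⟧) ∣ d) :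
    ∀ (m : ℕ) (e : A⟦X⟧), X ^ m * c' = d * e → d ∣ c' := by
  intro m
  induction m with
  | zero =>
    intro e he
    exact ⟨e, by rw [← he, pow_zero, one_mul]⟩
  | succ m ih =>
    intro e he
    have hXde : (X : A⟦X⟧) ∣ d * e := ⟨X ^ m * c', by rw [← he, pow_succ', mul_assoc]⟩
    obtain ⟨e₁, rfl⟩ := (X_prime.dvd_or_dvd hXde).resolve_left hXd
    refine ih e₁ (mul_left_cancel₀ X_ne_zero ?_)
    rw [← mul_assoc, ← pow_succ', he, mul_left_comm]

/-- **`μ = 0` of the anticyclotomic restriction ⇒ coprime to the cyclotomic subalgebra** (BSTW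
Part II §10.2.2: "Hence `𝓛^∘_p(g/L)` is coprime to height one prime ideals of `Λ^cyc_L`").
Dictionary: `A⟦X⟧ = Λ_L` with `A = ℤ_p⟦γ_ac − 1⟧`, `X = γ_cyc − 1`; `constantCoeff` = restriction to
the anticyclotomic line `γ_cyc = 1`; a "cyclotomic" element `c` is one all of whose nonzero
`X`-coefficients are `ϖ ^ k · (unit)` (`ϖ = p`: true for coefficients in `ℤ_p ⊂ ℤ_p⟦γ_ac − 1⟧`).
If `L(0) ≠ 0` and `ϖ ∤ L(0)` (anticyclotomic `μ`-invariant zero) then every common divisor of a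
nonzero cyclotomic `c` and of `L` is a unit. Proof: strip `X^{ord c}` (as `X ∤ d` since `L(0) ≠ 0`),
pass to constant terms (a ring map), and use `isUnit_of_dvd_prime_pow_mul_of_not_dvd` plus
`PowerSeries.isUnit_iff_constantCoeff`. [cite: BurungaleSkinnerTianWan2024, Part II §2.2.2 ("Hence 𝓛 is coprime to height one prime ideals of Λ^cyc"; ring-theoretic step only; PREPRINT)] -/
theorem isRelPrime_of_constantCoeff {ϖ : A} (hϖ : Prime ϖ) {c L : A⟦X⟧} (hc : c ≠ 0)
    (hcoef : ∀ n, coeff n c ≠ 0 → ∃ (k : ℕ) (u : A), IsUnit u ∧ coeff n c = ϖ ^ k * u)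
    (hL0 : constantCoeff L ≠ 0) (hμ : ¬ ϖ ∣ constantCoeff L) : IsRelPrime c L := by
  intro d hdc hdL
  -- `X ∤ d`, since `d ∣ L` and `L(0) ≠ 0`
  have hXd : ¬ (X : A⟦X⟧) ∣ d := fun h => hL0 (X_dvd_iff.mp (dvd_trans h hdL))
  -- strip the exact power of `X` dividing `c`
  have hdc' : d ∣ divXPowOrder c := by
    obtain ⟨e, he⟩ := hdc
    exact dvd_of_dvd_X_pow_mul_of_not_X_dvd hXd c.order.toNat e
      (by rw [X_pow_order_mul_divXPowOrder, he])
  -- constant terms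
  have h0 : constantCoeff (divXPowOrder c) ≠ 0 := by
    rw [Ne, constantCoeff_divXPowOrder_eq_zero_iff]
    exact hc
  have h0' : coeff c.order.toNat c ≠ 0 := by
    rw [← constantCoeff_divXPowOrder]
    exact h0
  obtain ⟨k, u, hu, hk⟩ := hcoef c.order.toNat h0'
  have hd0 : constantCoeff d ∣ ϖ ^ k * u := by
    rw [← hk, ← constantCoeff_divXPowOrder]
    exact map_dvd constantCoeff hdc'
  have hnd : ¬ ϖ ∣ constantCoeff d := fun h => hμ (dvd_trans h (map_dvd constantCoeff hdL))
  exact isUnit_iff_constantCoeff.mpr (isUnit_of_dvd_prime_pow_mul_of_not_dvd hϖ hu hnd k hd0)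

/-- **BSTW §10.2.2, the descent step as a theorem of commutative algebra.** In `Λ_L = A⟦X⟧` (assumed a
decomposition monoid — e.g. the UFD `ℤ_p⟦T₁, T₂⟧`): if `c · ξ = L · a` with `c` a nonzero cyclotomic
element (nonzero coefficients `ϖ^k ·` unit), and the anticyclotomic restriction `L(0)` is nonzero with
`ϖ ∤ L(0)`, then `L ∣ ξ`. This is exactly "the divisibility `𝓛 ∣ ξ(X)` in
`Λ_L ⊗_{Λ^cyc} Frac(Λ^cyc)` holds in `Λ_L`" granted `μ(𝓛^ac) = 0` and `𝓛^ac ≠ 0`; the `μ = 0` INPUT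
itself (Pollack–Weston / Vatsal on the quaternionic side plus the period comparison) is not touched
here. [cite: BurungaleSkinnerTianWan2024, Part II §2.2.2 ("the divisibility (tpm-div) holds in Λ_L"; ring-theoretic step only; PREPRINT)] -/
theorem dvd_of_mul_eq_mul_of_constantCoeff [DecompositionMonoid A⟦X⟧] {ϖ : A} (hϖ : Prime ϖ)
    {c ξ L a : A⟦X⟧} (hc : c ≠ 0)
    (hcoef : ∀ n, coeff n c ≠ 0 → ∃ (k : ℕ) (u : A), IsUnit u ∧ coeff n c = ϖ ^ k * u)
    (hL0 : constantCoeff L ≠ 0) (hμ : ¬ ϖ ∣ constantCoeff L) (h : c * ξ = L * a) : L ∣ ξ :=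
  dvd_of_mul_eq_mul_of_isRelPrime (isRelPrime_of_constantCoeff hϖ hc hcoef hL0 hμ).symm h

end Restriction

end Literature.NumberTheory.EllipticCurves.IwasawaTransfer

/-! ### The dual dictionary: a `T_v`-power defect never reaches the cyclotomic line

Read `A⟦X⟧ = Λ_L` now with `A = Λ^cyc = ℤ_p⟦γ_cyc − 1⟧` and `X = γ_ac − 1`, so that
`PowerSeries.constantCoeff` is the CYCLOTOMIC specialisation `γ_ac ↦ 1` (BSTW Part II Prop. 2.7:
`X_∘(g/L)/(γ_ac − 1) ≃ X^cyc_∘(g/L)`). In BSTW Part I §3.1.4 one has `γ_ac ↦ γ_v^{1/2}`, so the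
height-one prime `(T_v) = (γ_v − 1)` of the `Λ_L^v`-variable — the prime at which the canonical CM family
`𝐡_v` meets the Eisenstein family (Part I Thm. 3.22, `H_v = T_v · H_v^cusp`) and by which Part I §4.5.1
divides the second Coleman map (`𝓛_v̄ = θ⁻¹ ∘ T_v⁻¹𝓛^int ∘ Shapiro`) — is `(X)` up to the unit `X + 2`
(`p` odd): it is the prime of the cyclotomic line, not a prime "away from the BSD point". Consequently a
divisibility `L ∣ X ^ a * ξ` obtained upstairs (a Greenberg-side divisibility that is off by a power of
`T_v`, transported to the signed side) upgrades to `L ∣ ξ` as soon as the cyclotomic specialisation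
`L(0) = 𝓛^{∘,cyc}_p(g/L) = c^∘ · 𝓛^∘_γ(g) · 𝓛^∘_{γ'}(g')` is non-zero — which it is, by Rohrlich's
non-vanishing of `L(E, χ, 1)` for almost all `χ` of `p`-power conductor (Invent. Math. 75 (1984)).
This is the cell memo `bstw-MEMO-6` Part C (Theorem S5′); the induction is
`dvd_of_dvd_X_pow_mul_of_not_X_dvd` above. -/

namespace Literature.NumberTheory.EllipticCurves.IwasawaTransfer

section CyclotomicLine

open PowerSeries

variable {A : Type*} [CommRing A] [IsDomain A]

/-- **A `T_v`-power defect in a transported divisibility is harmless** (BSTW Part II §2.2.2 with Part I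
§4.5.1's normalisation `𝓛_v̄ = θ⁻¹ ∘ T_v⁻¹ · 𝓛^int`): in `Λ_L = A⟦X⟧` with `A = Λ^cyc`, `X = γ_ac − 1`
(`= T_v ·` unit), if the signed two-variable `p`-adic `L`-function `L` has non-zero cyclotomic
specialisation `constantCoeff L = L(0) ≠ 0` (Rohrlich) and `L ∣ X ^ a * ξ` for some `a`, then `L ∣ ξ`.
Pure commutative algebra (`X` is prime in the domain `A⟦X⟧`); the arithmetic inputs — the divisibility
upstairs and `L(0) ≠ 0` — are not asserted here. [cite: BurungaleSkinnerTianWan2024, Part I §4.5.1 (definition of the map 𝓛_v̄ with the factor 1/T_v) and Part II §2.2.2 (proof of the theorem labelled KoMC'_lb, "the divisibility (tpm-div) holds in Λ_L"); ring-theoretic step only; PREPRINT] -/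
theorem dvd_of_dvd_X_pow_mul_of_constantCoeff_ne_zero {L ξ : A⟦X⟧}
    (hL0 : constantCoeff L ≠ 0) (a : ℕ) (h : L ∣ X ^ a * ξ) : L ∣ ξ := by
  obtain ⟨e, he⟩ := h
  exact dvd_of_dvd_X_pow_mul_of_not_X_dvd (fun hX => hL0 (X_dvd_iff.mp hX)) a e he

/-- The same with an extra "cyclotomic constant" `s` already removed upstream: if `s * (X ^ a * ξ) = L * b`
with `L` relatively prime to `s` (the `μ = 0` step, `isRelPrime_of_constantCoeff` in the OTHER
dictionary) and `constantCoeff L ≠ 0`, then `L ∣ ξ` — i.e. the full upgrade "from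
`Λ_L ⊗_{Λ^cyc} Frac Λ^cyc` and up to a power of `T_v`" to "in `Λ_L`", granted a decomposition-monoid
structure on `A⟦X⟧` (e.g. the UFD `ℤ_p⟦T₊,T₋⟧`). [cite: BurungaleSkinnerTianWan2024, Part II §2.2.2 (proof of the theorem labelled KoMC'_lb, last paragraph) with Part I §4.5.1; ring-theoretic step only; PREPRINT] -/
theorem dvd_of_mul_eq_mul_of_isRelPrime_of_constantCoeff_ne_zero [DecompositionMonoid A⟦X⟧]
    {s L ξ b : A⟦X⟧} (hrel : IsRelPrime L s) (hL0 : constantCoeff L ≠ 0) (a : ℕ)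
    (h : s * (X ^ a * ξ) = L * b) : L ∣ ξ :=
  dvd_of_dvd_X_pow_mul_of_constantCoeff_ne_zero hL0 a (dvd_of_mul_eq_mul_of_isRelPrime hrel h)

end CyclotomicLine

end Literature.NumberTheory.EllipticCurves.IwasawaTransfer
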